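import Literature.NumberTheory.Automorphic.CDTThreeFiveSwitchProofs
import Literature.NumberTheory.GaloisRepresentations.ModThreeImageOrderEightAbsIrreducible
import HarnessLib

/-!
# Wiles' `3`–`5` switch — the named fact `BCDT.CDT_three_five_switch` DISCHARGED

`CDT_three_five_switch` (`CDTTheorem712`; Conrad–Diamond–Taylor 1999, proof of Thm. 7.1.2,
p. 556: "Wiles' argument using the Hilbert Irreducibility Theorem shows that there is an elliptic
curve `E'` over `ℚ` such that `ρ̄_{E',5} ≅ ρ̄_{E,5}` and `ρ̄_{E',3}|_{ℚ(√-3)}` is absolutely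
irreducible") is a THEOREM of the tree: `CDTThreeFiveSwitch.Road.CDT_three_five_switch_of_orderEightCriterion`
(Fisher's Hesse family of degree `5` — `KleinQuinticTorsionFrame.thm132_…`, certified section table and
syzygy — plus the icosahedral descent `CDTThreeFiveSwitchDescent.core1728_of_icosahedral_descent` and a
Frobenius certificate producing an element of order `8` in the image of `ρ̄_{E',3}`) fed with the
group criterion `ModThreeOrderEight.orderEightCriterion` (an element of order `8` and `det = χ̄₃` make
`ρ̄|_{ℚ(√-3)}` absolutely irreducible).  This file states the result under the fact's own name, so that
the facts probe records the discharge; consumers that took `(h : CDT_three_five_switch)` — e.g. the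
stub `stub_switch` of crux `FreyModularity` (route DefiniteXi, stmt-ABC-11340), whose registered
signature is `CDT_three_five_switch` unfolded — are fed `CDT_three_five_switch_holds`.

## References

* [ConradDiamondTaylor1999] B. Conrad, F. Diamond, R. Taylor, Modularity of certain potentially
  Barsotti–Tate Galois representations, J. Amer. Math. Soc. 12 (1999), proof of Thm. 7.1.2 (p. 556).
-/

namespace Literature.NumberTheory.Automorphic.BCDT

/-- **Wiles' `3`–`5` switch from a curve (CDT 1999, proof of Thm. 7.1.2, p. 556), the named fact
`BCDT.CDT_three_five_switch` discharged**: for `E/ℚ` with `27 ∤ N_E`, no framed model of `E[3]`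
absolutely irreducible over `ℚ(√-3)`, and a framed model `ρ̄` of `E[5]` absolutely irreducible over
`ℚ(√5)`, some elliptic curve `E'/ℚ` has `E'[5] ≅ ρ̄` and a framed model of `E'[3]` absolutely
irreducible over `ℚ(√-3)`. [cite: ConradDiamondTaylor1999, proof of Thm. 7.1.2 (p. 556)] -/
theorem CDT_three_five_switch_holds : CDT_three_five_switch :=
  _root_.Literature.NumberTheory.Automorphic.CDTThreeFiveSwitch.Road.CDT_three_five_switch_of_orderEightCriterion
    _root_.Literature.NumberTheory.GaloisRepresentations.ModThreeOrderEight.orderEightCriterion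

end Literature.NumberTheory.Automorphic.BCDT
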